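import Summits.BirchSwinnertonDyer.Rank1Residual.ManinAdditive.ShimuraIndexAtkinLehnerProofs
import Literature.NumberTheory.EllipticCurves.AtkinLehnerInvolutionsNewformProofs
import HarnessLib

/-!
# E-es-78 `AtkinLehnerNewformEigenvectorLaw` holds (input node of es's THEOREM AL chain), and E-es-71 by the es route

Summit `BirchSwinnertonDyer`, sub-problem `BirchSwinnertonDyer`, route `ManinLocalTwoThree`; width seat `bsd-line-manin23-p2`
(gen 9), `--supports` the crux C3 `ManinPrimeToThreeAtNine` (stmt-BirchSwinnertonDyer-22968).  Cell `bsd-f2-manin`, es lens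
leaf `…ManinAdditive.ShimuraIndexAtkinLehnerProofs` (typer T-es-26 part B): the registered input node E-es-78
(`AtkinLehnerNewformEigenvectorLaw := ∀ N, IsNewform0.exists_atkinLehnerInvolutionAt_eq_smul`) is «a literature-prover target
(`theorem atkinLehnerNewformEigenvectorLaw_holds` := the all-level Literature `_holds` once landed)».  The all-level Literature
theorem `IsNewform0.exists_atkinLehnerInvolutionAt_eq_smul_holds` (`AtkinLehnerInvolutionsNewformProofs`) IS in the tree, so the
node is discharged by one line; es's edge `atkinLehnerShimuraSignLaw_of_eigenvectorLaw` (E-es-71 ⟸ E-es-78) then gives THEOREM AL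
again (already landed as `ManinLocalTwoThree.atkinLehnerShimuraSignLaw_holds`, p655031, character-free CRT route — not restated).

PROVED here (no `sorry`): **`atkinLehnerNewformEigenvectorLaw_holds : AtkinLehnerNewformEigenvectorLaw`** (E-es-78 BY NAME).
BSD is not proved by this.
-/

set_option autoImplicit false
set_option linter.dupNamespace false

noncomputable section

open Literature.NumberTheory.EllipticCurves.ModularForms
open Summit.BirchSwinnertonDyer.Rank1Residual.ManinAdditive.KatoCurve

namespace Summit.BirchSwinnertonDyer.BirchSwinnertonDyer.Theorems.ManinLocalTwoThree

/-- **E-es-78 `AtkinLehnerNewformEigenvectorLaw` holds**: every newform on `Γ₀(N)` (weight `2`) is a `±1`-eigenvector of every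
`w_{Q_q}` — the tree's all-level Literature theorem `IsNewform0.exists_atkinLehnerInvolutionAt_eq_smul_holds`
(Atkin–Lehner 1970 Thm. 3). -/
theorem atkinLehnerNewformEigenvectorLaw_holds : AtkinLehnerNewformEigenvectorLaw :=
  fun _ _ => IsNewform0.exists_atkinLehnerInvolutionAt_eq_smul_holds

end Summit.BirchSwinnertonDyer.BirchSwinnertonDyer.Theorems.ManinLocalTwoThree

end
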